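import Summits.HubbardSuperconductivity.HubbardSuperconductivity.Theses.ChiralWindow
import Summits.HubbardSuperconductivity.HubbardSuperconductivity.Theorems.AposterioriCapRgSsbToEvenTorusLroFacePurityOfGcRepelledChord
import HarnessLib

/-!
# Crux `CwSsbToEvenTorusLRO` (stmt-HubbardSuperconductivity-10439, route `ChiralWindow`), line `griffiths-block-slope` —
the sorry-free GLUE of the lead's skeleton v4 (`Cruxes/CwSsbToEvenTorusLRO/Lines/griffiths_block_slope.lean`)

This helper file (proposed `--supports stmt-HubbardSuperconductivity-10439`; it proves the registered composition obligation
`cwSsbToEvenTorusLRO_of_sourceFreeBlockSlopeFloor`) lands the ROUTE-`ChiralWindow` packaging of the line's composition, so that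
the crux — and, at route level, `CwThesis` — are kernel-checked consequences of ONE open thermodynamic statement (S2' = the
grand-canonical repelled chord "GRC" `κ·a·L² ≤ E₀(K_μ + κW_R) − E₀(K_μ)`, ∀R ∃κ(R), even sides) plus the existing infrared item
stmt-HubbardSuperconductivity-1089 (`KacWindowPenalty.WindowInfraredBound`). Everything below the packaging is IMPORTED:
the lead of the sibling crux `AposterioriCapRg.SsbToEvenTorusLro` (stmt-1315) landed the same reshape independently
(`Theorems/AposterioriCapRgSsbToEvenTorusLroFacePurityOfGcRepelledChord.lean`: `gcRepelledChord_of_repelledOrderAt` = S2 ⇒ S2',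
`fp_chord_of_gcRepelledChordAt` = S2' + density matching ⇒ canonical CHORD, on top of this line's landed S1/S3/S4/S5), and the
twin crux's dissection gives `deriv_of_chord` / `floor_of_deriv_of_leak` / `hasDWavePairFieldLROAt_of_floor` /
`leak_of_windowInfraredBound`.

* `hasDWavePairFieldLROAt_of_slopeFloorAt` — pointwise: S2' at `(U, μ)` + density matching + the pointwise leak at `(U, δ)`,
  `δ ∈ (0, 1/2)` ⇒ the summit matrix at `(U, δ)`;
* `cwSsbToEvenTorusLRO_of_sourceFreeBlockSlopeFloor` (REGISTERED obligation), `cwSsbToEvenTorusLRO_of_repelledOrderPersistence` — the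
  crux BY NAME from the guarded S2' (resp. v3's sourced S2) statement and stmt-1089 BY NAME (CONDITIONAL glue);
* `cwThesis_of_slopeConstruction`, `cwThesis_of_repelledConstruction` — ROUTE-LEVEL: if the chiral construction certifies, at each
  weak `U`, a window `(δ_U, μ_U)` with density matching and S2' (resp. repelled order), then stmt-1089 alone gives `CwThesis` —
  the `∀μ` transfer and `CwGlue` drop out of route ChiralWindow (cf. the sibling's
  `hubbardSuperconductivity_of_gcRepelledChordPoint_of_windowInfraredBound`, which closes the SUMMIT from one GRC point + 1089).

Notation in docstrings: `K_μ = hubbardTorusWith 2 L 1 U μ`, `T_h = dWaveSourceTorus L U μ h`, `P = pairField dWaveFormFactor L`,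
`W_R = R⁻⁴ Σ_a B_aᴴ B_a`, `B_a = Σ_{u ∈ [0,R)²} P_{a+u}`, `E₀ = Matrix.groundEnergy`. No definitions. [folklore] bookkeeping over
the finite-dimensional variational principle (Tasaki 2020 §2.1; Koma–Tasaki 1994 §1) and the landed files named above.
-/

noncomputable section

set_option linter.dupNamespace false

namespace Summit.HubbardSuperconductivity.HubbardSuperconductivity.Theorems.CwSsbToEvenTorusLRO

open Literature.MathematicalPhysics.QuantumLattice Literature.Barriers.HubbardSuperconductivity
open Summit.HubbardSuperconductivity.WcbcsSsbToTorusLRO.Negative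
open Filter Set Matrix
open scoped Matrix ComplexOrder BigOperators
open _root_.Topology

/-! ## Pointwise matrix from the grand-canonical repelled chord (GRC = this line's S2') -/

/-- **POINTWISE MATRIX from the source-free slope floor (sorry-free).** At `δ ∈ (0, 1/2)`: density matching at `μ`, the
source-free block-slope floor at `(U, μ)` and the pointwise infrared LEAK at `(U, δ)` (what stmt-1089 gives) imply the summit
matrix at `(U, δ)` (`HasDWavePairFieldLROAt U δ`, definitionally the crux's consequent) — twin's landed `deriv_of_chord`,
`floor_of_deriv_of_leak` (Fejér closure), `hasDWavePairFieldLROAt_of_floor`. -/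
theorem hasDWavePairFieldLROAt_of_slopeFloorAt {U δ μ : ℝ} (hδ : δ ∈ Set.Ioo (0:ℝ) (1 / 2))
    (hdm : Filter.Tendsto (fun L : ℕ => ((hubbardTorusWith 2 (L + 1) 1 U μ).groundStateFunctional totalNumber).re / ((L + 1 : ℕ) : ℝ) ^ 2) Filter.atTop (nhds (1 - δ)))
    (hS : ∃ a : ℝ, 0 < a ∧ ∀ R : ℕ, 0 < R → ∃ κ : ℝ, 0 < κ ∧ ∀ᶠ k : ℕ in Filter.atTop, κ * a * ((2 * k + 1 + 1 : ℕ) : ℝ) ^ 2 ≤ (hubbardTorusWith 2 (2 * k + 1 + 1) 1 U μ + (κ : ℂ) • (((((R : ℝ) ^ 4)⁻¹ : ℝ) : ℂ) • ∑ a : Literature.Probability.LatticeModels.TorusSite 2 (2 * k + 1 + 1), (∑ u : Fin 2 → Fin R, localPair dWaveFormFactor (2 * k + 1 + 1) (a + fun i => ((u i : ℕ) : ZMod (2 * k + 1 + 1))))ᴴ * (∑ u : Fin 2 → Fin R, localPair dWaveFormFactor (2 * k + 1 + 1) (a + fun i => ((u i : ℕ) : ZMod (2 * k + 1 + 1)))))).groundEnergy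 - (hubbardTorusWith 2 (2 * k + 1 + 1) 1 U μ).groundEnergy)
    (hIR : ∀ b : ℝ, 0 < b → ∃ η : ℝ, 0 < η ∧ ∀ᶠ k : ℕ in Filter.atTop,
      ∀ ψ : Fock (Orb (FermionTorus 2 (2 * k + 1 + 1))),
        IsGroundStateInSector (hubbardTorus 2 (2 * k + 1 + 1) 1 U) (2 * ⌊(1 - δ) * (((2 * k + 1 + 1) : ℕ) : ℝ) ^ 2 / 2⌋₊) 0 ψ → star ψ ⬝ᵥ ψ = 1 →
          (∑ m ∈ (Finset.univ.filter fun m : Literature.Probability.LatticeModels.TorusSite 2 (2 * k + 1 + 1) =>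
              m ≠ 0 ∧ momentumNormSq (2 * k + 1 + 1) m < η ^ 2),
            pairStructureFactor dWaveFormFactor (2 * k + 1 + 1) ψ m) / ((2 * k + 1 + 1 : ℕ) : ℝ) ^ 2 ≤ b) :
    HasDWavePairFieldLROAt U δ :=
  hasDWavePairFieldLROAt_of_floor (floor_of_deriv_of_leak
    (deriv_of_chord (fp_chord_of_gcRepelledChordAt ⟨hδ.1, by linarith [hδ.2]⟩ hdm hS)) hIR)


/-! ## The crux and the route's thesis from the slope floor (conditional glue, sorry-free) -/

/-- **The crux from S2' (CONDITIONAL glue).** The guarded source-free block-slope floor (the registered stub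
`stub_sourceFreeBlockSlopeFloor` of the line, as a hypothesis — the shape a planner files as an item) and item stmt-1089
`KacWindowPenalty.WindowInfraredBound` BY NAME imply the crux `ChiralWindow.CwSsbToEvenTorusLRO` BY NAME. [folklore] -/
theorem cwSsbToEvenTorusLRO_of_sourceFreeBlockSlopeFloor :
    (∃ U₀ : ℝ, 0 < U₀ ∧ ∀ U ∈ Set.Ioo (0:ℝ) U₀, ∀ δ ∈ Set.Ioo (0:ℝ) (1 / 2), ∀ μ : ℝ, Filter.Tendsto (fun L : ℕ => ((hubbardTorusWith 2 (L + 1) 1 U μ).groundStateFunctional totalNumber).re / ((L + 1 : ℕ) : ℝ) ^ 2) Filter.atTop (nhds (1 - δ)) → HasDWaveOrder U μ → ∃ a : ℝ, 0 < a ∧ ∀ R : ℕ, 0 < R → ∃ κ : ℝ, 0 < κ ∧ ∀ᶠ k : ℕ in Filter.atTop, κ * a * ((2 * k + 1 + 1 : ℕ) : ℝ) ^ 2 ≤ (hubbardTorusWith 2 (2 * k + 1 + 1) 1 U μ + (κ : ℂ) • (((((R : ℝ) ^ 4)⁻¹ : ℝ) : ℂ) • ∑ a : Literature.Probability.LatticeModels.TorusSite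 2 (2 * k + 1 + 1), (∑ u : Fin 2 → Fin R, localPair dWaveFormFactor (2 * k + 1 + 1) (a + fun i => ((u i : ℕ) : ZMod (2 * k + 1 + 1))))ᴴ * (∑ u : Fin 2 → Fin R, localPair dWaveFormFactor (2 * k + 1 + 1) (a + fun i => ((u i : ℕ) : ZMod (2 * k + 1 + 1)))))).groundEnergy - (hubbardTorusWith 2 (2 * k + 1 + 1) 1 U μ).groundEnergy) → Summit.HubbardSuperconductivity.HubbardSuperconductivity.Theses.KacWindowPenalty.WindowInfraredBound → Summit.HubbardSuperconductivity.HubbardSuperconductivity.Theses.ChiralWindow.CwSsbToEvenTorusLRO := by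
  intro hS hW
  obtain ⟨U₀, hU₀, hS⟩ := hS
  refine ⟨U₀, hU₀, fun U hU δ hδ μ hdm hord => ?_⟩
  exact hasDWavePairFieldLROAt_of_slopeFloorAt hδ hdm (hS U hU δ hδ μ hdm hord)
    (leak_of_windowInfraredBound hW hU.1 hδ)

/-- **The crux from Transfer B (CONDITIONAL glue; v3's stub as hypothesis).** The guarded `R`-uniform sourced repelled-order
statement (v3's `stub_repelledOrderPersistence`, as a hypothesis) and stmt-1089 BY NAME imply the crux BY NAME — through
`slopeFloor_of_repelledOrderAt`. [folklore] -/
theorem cwSsbToEvenTorusLRO_of_repelledOrderPersistence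
    (hB : ∃ U₀ : ℝ, 0 < U₀ ∧ ∀ U ∈ Set.Ioo (0:ℝ) U₀, ∀ δ ∈ Set.Ioo (0:ℝ) (1 / 2), ∀ μ : ℝ, Filter.Tendsto (fun L : ℕ => ((hubbardTorusWith 2 (L + 1) 1 U μ).groundStateFunctional totalNumber).re / ((L + 1 : ℕ) : ℝ) ^ 2) Filter.atTop (nhds (1 - δ)) → HasDWaveOrder U μ → ∃ a : ℝ, 0 < a ∧ ∀ R : ℕ, 0 < R → ∃ κ : ℝ, 0 < κ ∧ ∃ h₀ : ℝ, 0 < h₀ ∧ ∀ h ∈ Set.Ioo (0:ℝ) h₀, ∀ᶠ L : ℕ in Filter.atTop, a ≤ ((dWaveSourceTorus (L + 1) U μ h + (κ : ℂ) • (((((R : ℝ) ^ 4)⁻¹ : ℝ) : ℂ) • ∑ a : Literature.Probability.LatticeModels.TorusSite 2 (L + 1), (∑ u : Fin 2 → Fin R, localPair dWaveFormFactor (L + 1) (a + fun i => ((u i : ℕ) : ZMod (L + 1))))ᴴ * (∑ u : Fin 2 → Fin R, localPair dWaveFormFactor (L + 1) (a + fun i => ((u i : ℕ) : ZMod (L +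 1)))))).groundStateFunctional (pairField dWaveFormFactor (L + 1))).re / ((L + 1 : ℕ) : ℝ) ^ 2)
    (hW : Summit.HubbardSuperconductivity.HubbardSuperconductivity.Theses.KacWindowPenalty.WindowInfraredBound) :
    Summit.HubbardSuperconductivity.HubbardSuperconductivity.Theses.ChiralWindow.CwSsbToEvenTorusLRO := by
  obtain ⟨U₀, hU₀, hB⟩ := hB
  refine ⟨U₀, hU₀, fun U hU δ hδ μ hdm hord => ?_⟩
  exact hasDWavePairFieldLROAt_of_slopeFloorAt hδ hdm (gcRepelledChord_of_repelledOrderAt (hB U hU δ hδ μ hdm hord))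
    (leak_of_windowInfraredBound hW hU.1 hδ)

/-- **ROUTE-LEVEL (CONDITIONAL glue): the transfer crux dissolves into a SLOPE clause of the construction.** If the chiral
construction certifies, at every weak `U`, some window doping `δ_U ∈ [3/10, 12/25]` and `μ_U` with density matching AND the
source-free block-slope floor at `(U, μ_U)` (a difference of two grand-canonical ground-state energy densities), then item
stmt-1089 alone yields `ChiralWindow.CwThesis` — no `∀μ` transfer item, no `CwGlue`, no source. [folklore] -/
theorem cwThesis_of_slopeConstruction
    (hC : ∃ U₀ : ℝ, 0 < U₀ ∧ ∀ U ∈ Set.Ioo (0:ℝ) U₀, ∃ δ ∈ Set.Icc (3/10 : ℝ) (12/25), ∃ μ : ℝ, (Filter.Tendsto (fun L : ℕ => ((hubbardTorusWith 2 (L + 1) 1 U μ).groundStateFunctional totalNumber).re / ((L + 1 : ℕ) : ℝ) ^ 2) Filter.atTop (nhds (1 - δ))) ∧ ∃ a : ℝ, 0 < a ∧ ∀ R : ℕ, 0 < R → ∃ κ : ℝ, 0 < κ ∧ ∀ᶠ k : ℕ in Filter.atTop, κ * a * ((2 * k + 1 + 1 : ℕ) : ℝ) ^ 2 ≤ (hubbardTorusWith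 2 (2 * k + 1 + 1) 1 U μ + (κ : ℂ) • (((((R : ℝ) ^ 4)⁻¹ : ℝ) : ℂ) • ∑ a : Literature.Probability.LatticeModels.TorusSite 2 (2 * k + 1 + 1), (∑ u : Fin 2 → Fin R, localPair dWaveFormFactor (2 * k + 1 + 1) (a + fun i => ((u i : ℕ) : ZMod (2 * k + 1 + 1))))ᴴ * (∑ u : Fin 2 → Fin R, localPair dWaveFormFactor (2 * k + 1 + 1) (a + fun i => ((u i : ℕ) : ZMod (2 * k + 1 + 1)))))).groundEnergy - (hubbardTorusWith 2 (2 * k + 1 + 1) 1 U μ).groundEnergy)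
    (hW : Summit.HubbardSuperconductivity.HubbardSuperconductivity.Theses.KacWindowPenalty.WindowInfraredBound) :
    Summit.HubbardSuperconductivity.HubbardSuperconductivity.Theses.ChiralWindow.CwThesis := by
  obtain ⟨U₀, hU₀, hC⟩ := hC
  refine ⟨U₀, hU₀, fun U hU => ?_⟩
  obtain ⟨δ, hδ, μ, hdm, hS⟩ := hC U hU
  have hδ' : δ ∈ Set.Ioo (0:ℝ) (1 / 2) := ⟨by linarith [hδ.1], by linarith [hδ.2]⟩
  exact ⟨δ, hδ, hasDWavePairFieldLROAt_of_slopeFloorAt hδ' hdm hS (leak_of_windowInfraredBound hW hU.1 hδ')⟩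

/-- **ROUTE-LEVEL, sourced form (CONDITIONAL glue).** The chiral construction run WITH the block term and the source (repelled
Koma–Tasaki order with an `R`-uniform floor at some window `(δ_U, μ_U)` with density matching) plus stmt-1089 yields
`ChiralWindow.CwThesis`. [folklore] -/
theorem cwThesis_of_repelledConstruction
    (hC : ∃ U₀ : ℝ, 0 < U₀ ∧ ∀ U ∈ Set.Ioo (0:ℝ) U₀, ∃ δ ∈ Set.Icc (3/10 : ℝ) (12/25), ∃ μ : ℝ, (Filter.Tendsto (fun L : ℕ => ((hubbardTorusWith 2 (L + 1) 1 U μ).groundStateFunctional totalNumber).re / ((L + 1 : ℕ) : ℝ) ^ 2) Filter.atTop (nhds (1 - δ))) ∧ ∃ a : ℝ, 0 < a ∧ ∀ R : ℕ, 0 < R → ∃ κ : ℝ, 0 < κ ∧ ∃ h₀ : ℝ, 0 < h₀ ∧ ∀ h ∈ Set.Ioo (0:ℝ) h₀, ∀ᶠ L : ℕ in Filter.atTop, a ≤ ((dWaveSourceTorus (L + 1) U μ h + (κ : ℂ) • (((((R : ℝ) ^ 4)⁻¹ : ℝ) : ℂ) • ∑ a : Literature.Probability.LatticeModels.TorusSite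 2 (L + 1), (∑ u : Fin 2 → Fin R, localPair dWaveFormFactor (L + 1) (a + fun i => ((u i : ℕ) : ZMod (L + 1))))ᴴ * (∑ u : Fin 2 → Fin R, localPair dWaveFormFactor (L + 1) (a + fun i => ((u i : ℕ) : ZMod (L + 1)))))).groundStateFunctional (pairField dWaveFormFactor (L + 1))).re / ((L + 1 : ℕ) : ℝ) ^ 2)
    (hW : Summit.HubbardSuperconductivity.HubbardSuperconductivity.Theses.KacWindowPenalty.WindowInfraredBound) :
    Summit.HubbardSuperconductivity.HubbardSuperconductivity.Theses.ChiralWindow.CwThesis := by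
  obtain ⟨U₀, hU₀, hC⟩ := hC
  refine ⟨U₀, hU₀, fun U hU => ?_⟩
  obtain ⟨δ, hδ, μ, hdm, hBa⟩ := hC U hU
  have hδ' : δ ∈ Set.Ioo (0:ℝ) (1 / 2) := ⟨by linarith [hδ.1], by linarith [hδ.2]⟩
  exact ⟨δ, hδ, hasDWavePairFieldLROAt_of_slopeFloorAt hδ' hdm (gcRepelledChord_of_repelledOrderAt hBa)
    (leak_of_windowInfraredBound hW hU.1 hδ')⟩

end Summit.HubbardSuperconductivity.HubbardSuperconductivity.Theorems.CwSsbToEvenTorusLRO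

end
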